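import Summits.BirchSwinnertonDyer.BirchSwinnertonDyer.Theorems.EdixhovenFibreFiveSevenDeRhamAtFiveSevenPotentiallyGood
import Summits.BirchSwinnertonDyer.BirchSwinnertonDyer.Theorems.EdixhovenFibreFiveSevenTwistDegreeStepFiveSevenOfKatoTransfer
import Literature.NumberTheory.EllipticCurves.DualExpEllipticReciprocityLaw
import HarnessLib

/-!
# Crux KP57 `KPResidueManinUnitFiveSeven` (stmt-BirchSwinnertonDyer-23810) and crux TDS57 `TwistDegreeStepFiveSeven`
# (stmt-BirchSwinnertonDyer-22227) BY NAME, GRANTED ONLY {P1-bar, [REC-tower] (or hT₂)} (+ modularity) —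
# no F″, no Fontaine cite, no Ihara lemma, no KP57 hypothesis

Cell `pub/bsd-wall`, seat `bsd-line-edix-p1` g19 (LEAD of line `kato_lever`, crux K★ stmt-BirchSwinnertonDyer-22226; this file
`--supports` KP57 stmt-BirchSwinnertonDyer-23810 as a helper). TOOL theorems only (no definition, no named fact, no `sorry`);
nothing is closed; BSD is not proved by any of this.

WHAT. The Kosters–Pannekoek repair of the route (`TwistDegreeStepFiveSevenUnitTwist.not_dvd_optimal_c_of_kato_of_unitTwist`,
edix-p2; transfer road `LTwistTransfer.exists_datum_not_dvd_c_of_kato_of_transferWitness_of_torsion`, edix-p3, with the PROVED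
Chebotarev witness `AuxPrime.transferWitness`, manin-p1) reads Kato's integrality F″ (`kato_neron_isIntegral_twistedSymbolSum_of_additive_five_le`,
cite-only, universal) at ONE place: the tame-twist lever `exists_member_not_dvd_c_of_tameTwist57` on the class of a globally minimal
model `Vχ` of `V₀ ⊗ χ_{q*}` (`V₀` the optimal member of the class of `V`, `q` the auxiliary prime). This file re-runs it through the
PER-CLASS socket of the line — `ManinFrameResidueProperRTameTwistAt.exists_member_not_dvd_c_of_tameTwist57_at` fed by
`KatoAssemblySocketAt.katoNeronBody_of_sl2NeronValuesBar_of_isDeRhamAt` (P1 print-faithful: `exists_member_sl2ZetaElement_neron_values_bar`,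
DD-UE-1; Kato II Prop. 1.2.3 = `cupLogInjective_and_hasDualExp_of_isDeRham_holds`) — whose de Rham input on the twisted class is the
THEOREM `DeRhamAtFiveSeven.isDeRham_adicCompletion_rat_fiveSeven_of_unitTwist_member` (every cell at `p ∈ {5, 7}`; it consumes the
item's «no `Iₙ*` fibre» hypothesis, which the F″ road did not use).

* `not_dvd_optimal_c_of_expStarTower_of_sl2NeronValuesBar_of_unitTwist` — the repair per curve GRANTED {hT₂, P1-bar, modularity}.
* `exists_datum_not_dvd_c_of_expStarTower_of_sl2NeronValuesBar_of_torsion` — a conductor-level datum with `p ∤ c` on the KP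
  sub-residue (additive at `p ∈ {5, 7}`, `E[p]` irreducible, no `Iₙ*`, a member with a `ℚ_p`-rational point of order `p`).
* ★★ `kpResidueManinUnitFiveSeven_of_expStarTower_of_sl2NeronValuesBar : exists_isNewformOf → hT₂ → P1-bar → KP57` and
  ★★ `kpResidueManinUnitFiveSeven_of_reciprocityLaw_of_sl2NeronValuesBar : exists_isNewformOf → [REC-tower] → P1-bar → KP57`.
* ★★ `twistDegreeStepFiveSeven_of_expStarTower_of_sl2NeronValuesBar : hT₂ → P1-bar → TDS57` and
  ★★ `twistDegreeStepFiveSeven_of_reciprocityLaw_of_sl2NeronValuesBar : [REC-tower] → P1-bar → TDS57` — off the KP sub-residue by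
  `TwistDegreeStepFiveSevenCellFiveII.twistDegreeStep57_of_sl2NeronValuesBar_of_noTorsion` (g18), on it by the above.

NET for the route: the four Manin binders of `closes` — K★ (22226, `…OfReciprocityLaw`, p701880), TDS57 (22227), TDS11 (22228,
`…TwistDegreeStepOrdinaryOfReciprocityLaw`, p704378) and KP57 (23810) — rest on EXACTLY the two print-faithful published inputs
P1-bar (Kato 2004 Thm. 6.6 (1) / (8.1.3) / Thm. 9.7) and [REC-tower] (Kato 1993 II Thm. 1.4.1 (4)), plus modularity
(`exists_isNewformOf`, a binder of TDS57 itself). CONDITIONAL; the items stay OPEN; BSD is not proved by any of this.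

References: [Kato2004Asterisque] Thm. 6.6 (1), (8.1.3), Thm. 9.7; [Kato1993LNM1553] Ch. II Thm. 1.4.1 (4), Prop. 1.2.3; [KostersPannekoek2017]
Thm. 1, Cor. 2; [Stevens1989] Lemma (5.2); [EdixhovenManin1991] §4; [TateGCFT1967] §2.4.
-/

set_option autoImplicit false
-- the Theorems namespace of a single-conjunct summit repeats the summit name by design (D-0017)
set_option linter.dupNamespace false

noncomputable section

open scoped Classical MatrixGroups NumberField

open WeierstrassCurve NumberField IsDedekindDomain Field ValuativeRel
  Literature.NumberTheory.EllipticCurves Literature.NumberTheory.EllipticCurves.ModularForms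
  Literature.NumberTheory.EllipticCurves.Rank1Residual Literature.NumberTheory.EllipticCurves.Kato2004
  Literature.NumberTheory.DiophantineGeometry Rat.HeightOneSpectrum
  Literature.NumberTheory.PAdicHodge Literature.NumberTheory.GaloisRepresentations
  Summit.BirchSwinnertonDyer.Rank1Residual Summit.BirchSwinnertonDyer.Rank1Residual.Additive
  Summit.BirchSwinnertonDyer.BirchSwinnertonDyer.Theorems
  Summit.BirchSwinnertonDyer.BirchSwinnertonDyer.Theorems.KatoAssemblySocketAt
  Summit.BirchSwinnertonDyer.BirchSwinnertonDyer.Theorems.ManinFrameResidueProperRTameTwistAt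
  Summit.BirchSwinnertonDyer.BirchSwinnertonDyer.Theorems.TwistDegreeStepFiveSevenUnitTwist
  Summit.BirchSwinnertonDyer.BirchSwinnertonDyer.Theorems.TwistDegreeStepFiveSevenCellFiveII
  Summit.BirchSwinnertonDyer.BirchSwinnertonDyer.Theses.EdixhovenFibreFiveSeven
  CongruenceSubgroup Complex

namespace Summit.BirchSwinnertonDyer.BirchSwinnertonDyer.Theorems.KPResidueOfReciprocityLaw

/-- A datum with `p ∤ c` at level `N` is one at any level `M = N`. [folklore] -/
private theorem exists_datum_not_dvd_of_level_eq {W : WeierstrassCurve ℚ} {N M : ℕ} [NeZero N]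
    [NeZero M] (h : N = M) {p : ℕ} (D : ModularParametrizationData W N) (hc : ¬ (p : ℤ) ∣ D.c) :
    ∃ D' : ModularParametrizationData W M, ¬ (p : ℤ) ∣ D'.c := by
  subst h
  exact ⟨D, hc⟩

variable {p : ℕ} [hp : Fact p.Prime]

/-! ### §1 The Kosters–Pannekoek repair per curve, GRANTED {hT₂, P1-bar, modularity} -/

/-- **Manin's `p`-part at a lattice-optimal datum from the auxiliary unit twist, GRANTED hT₂, P1-bar and modularity** — the
proof of `TwistDegreeStepFiveSevenUnitTwist.not_dvd_optimal_c_of_kato_of_unitTwist` verbatim, with the universal F″ replaced by the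
per-class socket `katoNeronBody_of_sl2NeronValuesBar_of_isDeRhamAt` inside `exists_member_not_dvd_c_of_tameTwist57_at`, its de Rham
input on the class of `Vχ` being the theorem `DeRhamAtFiveSeven.isDeRham_adicCompletion_rat_fiveSeven_of_unitTwist_member` (this uses
«`V` additive, `E[p]` irreducible, no `Iₙ*` at `p`» and `V ∼ V₀`). Data: `V₀` globally minimal with a LATTICE-OPTIMAL datum `D₀`, `q ≠ 2, p`
a prime where `V₀` is good or multiplicative, `Vχ` a globally minimal model of `V₀ ⊗ χ_{q*}` whose class has no `ℚ_p`-rational point of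
order `p`, `s² = q*`, and (L) `Λ(D₀.f) ⊆ s·Λ(g) + p·Λ(D₀.f)` for every newform `g` of `Vχ`. Then `p ∤ c(D₀)`. CONDITIONAL on the cite-only
hT₂ / P1-bar. [cite: Kato2004Asterisque, Thm. 6.6 (1) (p. 163), (8.1.3) (p. 180), Thm. 9.7 (p. 189)] [cite: Kato1993LNM1553, Ch. II Prop. 1.2.3 and Ex. 1.3.5]
[cite: Stevens1989, Lemma (5.2) p. 96] [cite: KostersPannekoek2017, Thm. 1 and Cor. 2] -/
theorem not_dvd_optimal_c_of_expStarTower_of_sl2NeronValuesBar_of_unitTwist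
    (hT₂ : exists_smul_range_expStarCoord_tower_iff_trace_log) (hP1 : exists_member_sl2ZetaElement_neron_values_bar)
    (hnf : exists_isNewformOf) (hp57 : p = 5 ∨ p = 7)
    (V : WeierstrassCurve ℚ) [V.IsElliptic] [V.IsGloballyMinimal] (hadd : Addv V p) (hirr : Irr V p)
    (hK : ∀ (v : HeightOneSpectrum ℤ) (n : ℕ), natGenerator v = p → V.kodairaSymbolAt v ≠ KodairaSymbol.Istar n)
    (V₀ : WeierstrassCurve ℚ) [V₀.IsElliptic] [V₀.IsGloballyMinimal] [NeZero (V₀.conductorNorm ℤ)] (hiso : IsIsogenous V V₀)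
    (D₀ : ModularParametrizationData V₀ (V₀.conductorNorm ℤ))
    (hopt₀ : ∀ z ∈ D₀.L.lattice, ∃ w ∈ periodLattice D₀.f, z = D₀.c * w)
    {q : ℕ} [Fact q.Prime] (hq2 : q ≠ 2) (hqp : q ≠ p)
    (hq : V₀.HasGoodReductionAtPrime q ∨ V₀.HasMultiplicativeReductionAtPrime q)
    (Vχ : WeierstrassCurve ℚ) [Vχ.IsElliptic] [Vχ.IsGloballyMinimal] [NeZero (Vχ.conductorNorm ℤ)]
    (v : VariableChange ℚ) (hv : v • V₀.quadraticTwist (((-1 : ℤ) ^ (q / 2) * q : ℤ) : ℚ) = Vχ)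
    (hPTχ : ∀ (W' : WeierstrassCurve ℚ) [W'.IsElliptic] [W'.IsGloballyMinimal], IsIsogenous Vχ W' →
      ∀ P : (W'.baseChange ℚ_[p]).toAffine.Point, p • P = 0 → P = 0)
    (s : ℂ) (hs2 : s ^ 2 = (((-1 : ℤ) ^ (q / 2) * q : ℤ) : ℂ))
    (hL : ∀ (N' : ℕ) [NeZero N'] (g : CuspForm (Gamma0 N') 2), IsNewformOf Vχ g →
      ∀ z ∈ periodLattice D₀.f, ∃ w ∈ periodLattice g, ∃ y ∈ periodLattice D₀.f,
        z = s * w + (p : ℂ) * y) :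
    ¬ (p : ℤ) ∣ D₀.c := by
  have hp2 : p ≠ 2 := by omega
  -- `Vχ` additive at `p`, `E^χ[p]` irreducible
  have hadd₀ : Addv V₀ p := (X2.addv_iff_of_isIsogenous (p := p) hiso).mp hadd
  have hirr₀ : Irr V₀ p := (X12.irr_iff_of_isIsogenous hiso p).mp hirr
  have haddχ : Addv Vχ p := AddvUnitTwist.addv_of_model_twist_auxPrime hp2 Fact.out hqp hadd₀ ⟨v, hv⟩
  have hd0 : ((((-1 : ℤ) ^ (q / 2) * q : ℤ)) : ℚ) ≠ 0 := by
    have : ((-1 : ℤ) ^ (q / 2) * q : ℤ) ≠ 0 :=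
      mul_ne_zero (pow_ne_zero _ (by norm_num)) (by exact_mod_cast (Fact.out : q.Prime).ne_zero)
    exact_mod_cast this
  have hv' : v⁻¹ • Vχ = V₀.quadraticTwist (((-1 : ℤ) ^ (q / 2) * q : ℤ) : ℚ) := by rw [← hv, inv_smul_smul]
  have hirrχ : Irr Vχ p :=
    BurungaleSkinnerTianWan2024.hasIrreducibleModPGaloisRep_of_smul_eq_quadraticTwist V₀ Vχ p hd0 hv' hirr₀
  -- the lever on the twisted class through the per-class socket, de Rham DISCHARGED; transported to `Vχ`
  obtain ⟨A, hEA, hMA, DA, hisoA, hcA⟩ := exists_member_not_dvd_c_of_tameTwist57_at hnf Vχ hp57 haddχ hirrχ hPTχ (by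
    intro W₀ _ _ hiso₀ M _ g hg hp5 hng hnm hirr' m _ hcop hcl χ hχ hχ1 hord ϖ r
    refine katoNeronBody_of_sl2NeronValuesBar_of_isDeRhamAt hT₂ cupLogInjective_and_hasDualExp_of_isDeRham_holds hP1 W₀ p
      ?_ g hg hp5 hng hnm hirr' m hcop hcl χ hχ hχ1 hord ϖ r
    intro w hpw _ _ _ hp' _
    exact DeRhamAtFiveSeven.isDeRham_adicCompletion_rat_fiveSeven_of_unitTwist_member V hp57 hadd hirr hK V₀ hiso hq2 hqp Vχ
      v hv W₀ hiso₀ w hpw hp')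
  haveI := hEA
  haveI := hMA
  obtain ⟨Dχ, hcχ⟩ :=
    ManinFrameTransport.exists_modularParametrizationData_not_dvd_of_partner Vχ hp.out hirrχ hisoA DA hcA
  -- Stevens and the lattice algebra
  exact not_dvd_c_of_twistedPeriodDecomposition D₀ Dχ hp.out hopt₀ hcχ s
    (smul_mem_neronLattice_of_twist D₀ Dχ hq2 hq v hv s hs2) (hL _ Dχ.f Dχ.isNewformOf)

/-! ### §2 A conductor-level datum with `p ∤ c` on the Kosters–Pannekoek sub-residue -/

/-- **A conductor-level datum with `p ∤ c` on the Kosters–Pannekoek residue, GRANTED hT₂, P1-bar and modularity.** For `p ∈ {5, 7}`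
and `V/ℚ` globally minimal, additive at `p`, `E[p]` irreducible, NO `Iₙ*` FIBRE at `p`, whose class contains a globally minimal member with a
`ℚ_p`-rational point of order `p`: some conductor-level datum `D` of `V` has `p ∤ c(D)`. Proof = the transfer road
`LTwistTransfer.exists_datum_not_dvd_c_of_kato_of_transferWitness_of_torsion` verbatim (optimal member `X12.exists_isIsogenous_optimal`,
witness prime `AuxPrime.transferWitness`, minimal model of the `q*`-twist `exists_minimal_twist_pStar`, TORS-TWIST `TorsTwist.torsTwist57_input`,
Ihara-free L-TWIST `lTwist_of_transfer`) ending in §1 instead of the F″ repair, then prime-to-`p` transport back to `V`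
(`ManinFrameTransport.exists_modularParametrizationData_not_dvd_of_partner`). CONDITIONAL on hT₂ / P1-bar.
[cite: Kato2004Asterisque, (8.1.3) (p. 180), Thm. 9.7 (p. 189)] [cite: KostersPannekoek2017, Thm. 1 and Cor. 2] [cite: Stevens1989, Lemma (5.2) p. 96]
[cite: TateGCFT1967, §2.4] -/
theorem exists_datum_not_dvd_c_of_expStarTower_of_sl2NeronValuesBar_of_torsion
    (hT₂ : exists_smul_range_expStarCoord_tower_iff_trace_log) (hP1 : exists_member_sl2ZetaElement_neron_values_bar)
    (hnf : exists_isNewformOf)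
    (V : WeierstrassCurve ℚ) [V.IsElliptic] [V.IsGloballyMinimal] [NeZero (V.conductorNorm ℤ)]
    (hp57 : p = 5 ∨ p = 7) (hadd : Addv V p) (hirr : Irr V p)
    (hK : ∀ (v : HeightOneSpectrum ℤ) (n : ℕ), natGenerator v = p → V.kodairaSymbolAt v ≠ KodairaSymbol.Istar n)
    (hW' : ∃ (W' : WeierstrassCurve ℚ) (_ : W'.IsElliptic) (_ : W'.IsGloballyMinimal)
      (P : (W'.baseChange ℚ_[p]).toAffine.Point), IsIsogenous V W' ∧ P ≠ 0 ∧ p • P = 0) :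
    ∃ D : ModularParametrizationData V (V.conductorNorm ℤ), ¬ (p : ℤ) ∣ D.c := by
  obtain ⟨W', hE', hM', P, hisoW', hP0, hP⟩ := hW'
  -- the optimal member of the class of `V`
  obtain ⟨V₀, hE₀, hM₀, hNz₀, D₀, hiso, -, hopt₀⟩ := X12.exists_isIsogenous_optimal hnf V
  haveI := hE₀
  haveI := hM₀
  haveI := hNz₀
  have hirr₀ : Irr V₀ p := (X12.irr_iff_of_isIsogenous hiso p).mp hirr
  have hadd₀ : Addv V₀ p := (X2.addv_iff_of_isIsogenous (p := p) hiso).mp hadd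
  have hisoVW : IsIsogenous V₀ W' := (hiso.symm_of_charZero).trans' hisoW'
  -- the witness prime (Chebotarev, PROVED)
  obtain ⟨q, hq, hq2, hqp, hqN', hnsq, hu⟩ := AuxPrime.transferWitness p V₀ hp57 hadd₀ hirr₀
  haveI : Fact q.Prime := ⟨hq⟩
  have hqsq : ¬ q ^ 2 ∣ V₀.conductorNorm ℤ := fun h ↦ hqN' ((dvd_pow_self q two_ne_zero).trans h)
  have hgm : V₀.HasGoodReductionAtPrime q ∨ V₀.HasMultiplicativeReductionAtPrime q :=
    hasGoodReductionAtPrime_or_hasMultiplicativeReductionAtPrime_of_not_sq_dvd_conductorNorm (V := V₀) hqsq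
  -- a globally minimal model of the twist, and a square root of `q*`
  obtain ⟨Vχ, hEχ, hMχ, v, hv⟩ := exists_minimal_twist_pStar q V₀
  haveI := hEχ
  haveI := hMχ
  haveI : NeZero (Vχ.conductorNorm ℤ) := ⟨(Vχ.conductorNorm_pos_holds).ne'⟩
  have hv' : v • V₀.quadraticTwist (((-1 : ℤ) ^ (q / 2) * q : ℤ) : ℚ) = Vχ := by
    rw [(pStar_intCast q).1]; exact hv
  obtain ⟨s, hs2⟩ := IsAlgClosed.exists_pow_nat_eq ((((-1 : ℤ) ^ (q / 2) * q : ℤ)) : ℂ) two_pos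
  -- TORS-TWIST: no `ℚ_p`-rational `p`-torsion on the twisted class
  have hPTχ := TorsTwist.torsTwist57_input p q V₀ hp57 hadd₀ hirr₀ hqp hnsq
    ⟨W', hE', hM', P, hisoVW, hP0, hP⟩ Vχ v hv'
  -- L-TWIST at the witness prime, WITHOUT Ihara
  have hL : ∀ (N' : ℕ) [NeZero N'] (g : CuspForm (Gamma0 N') 2), IsNewformOf Vχ g →
      ∀ z ∈ periodLattice D₀.f, ∃ w ∈ periodLattice g, ∃ y ∈ periodLattice D₀.f,
        z = s * w + (p : ℂ) * y :=
    fun N' _ g hg ↦ LTwistTransfer.lTwist_of_transfer V₀ D₀ hq2 hqp hqN' hu Vχ v hv' s hs2 g hg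
  -- §1 at the optimal member, then transport back to `V`
  have hc₀ : ¬ (p : ℤ) ∣ D₀.c :=
    not_dvd_optimal_c_of_expStarTower_of_sl2NeronValuesBar_of_unitTwist hT₂ hP1 hnf hp57 V hadd hirr hK V₀ hiso D₀ hopt₀ hq2
      hqp hgm Vχ v hv' hPTχ s hs2 hL
  obtain ⟨D, hc⟩ :=
    ManinFrameTransport.exists_modularParametrizationData_not_dvd_of_partner V hp.out hirr hiso D₀ hc₀
  have hN : V₀.conductorNorm ℤ = V.conductorNorm ℤ :=
    IsNewformOf.level_eq_conductorNorm_of_exists_isNewformOf hnf D.isNewformOf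
  exact exists_datum_not_dvd_of_level_eq hN D hc

/-! ### §3 KP57 BY NAME -/

/-- ★★ **KP57 `KPResidueManinUnitFiveSeven` (stmt-BirchSwinnertonDyer-23810) GRANTED ONLY modularity, hT₂ and P1-bar** — of the item's
hypotheses `p ∈ {5, 7}`, additivity, `E[p]`-irreducibility, «no `Iₙ*`» and the `ℚ_p`-rational `p`-torsion witness are used. No F″, no
Fontaine cite, no Ihara lemma. CONDITIONAL; the item stays OPEN for its own signature; BSD is not proved by this.
[cite: Kato2004Asterisque, Thm. 6.6 (1) (p. 163), (8.1.3) (p. 180), Thm. 9.7 (p. 189)] [cite: KostersPannekoek2017, Thm. 1 and Cor. 2] -/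
theorem kpResidueManinUnitFiveSeven_of_expStarTower_of_sl2NeronValuesBar (hnf : exists_isNewformOf)
    (hT₂ : exists_smul_range_expStarCoord_tower_iff_trace_log) (hP1 : exists_member_sl2ZetaElement_neron_values_bar) :
    KPResidueManinUnitFiveSeven := by
  intro p _ V _ _ _ hp57 hadd hirr hK _ hW' _ _
  exact exists_datum_not_dvd_c_of_expStarTower_of_sl2NeronValuesBar_of_torsion hT₂ hP1 hnf V hp57 hadd hirr hK hW'

/-- ★★ **KP57 `KPResidueManinUnitFiveSeven` (stmt-BirchSwinnertonDyer-23810) GRANTED ONLY modularity, Kato's explicit reciprocity law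
[REC-tower] and P1-bar** (hT₂ := `exists_smul_range_expStarCoord_tower_iff_trace_log_of_reciprocityLaw hrec`, p700964) — the same two printed
inputs as K★ (22226). CONDITIONAL; the item stays OPEN; BSD is not proved by this.
[cite: Kato1993LNM1553, Ch. II Thm. 1.4.1 (4), Lemma 1.4.3–1.4.5] [cite: Kato2004Asterisque, (8.1.3) (p. 180), Thm. 9.7 (p. 189)] -/
theorem kpResidueManinUnitFiveSeven_of_reciprocityLaw_of_sl2NeronValuesBar (hnf : exists_isNewformOf)
    (hrec : tatePairingPoint_eq_trace_expStar_log_tower) (hP1 : exists_member_sl2ZetaElement_neron_values_bar) :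
    KPResidueManinUnitFiveSeven :=
  kpResidueManinUnitFiveSeven_of_expStarTower_of_sl2NeronValuesBar hnf
    (exists_smul_range_expStarCoord_tower_iff_trace_log_of_reciprocityLaw hrec) hP1

/-! ### §4 TDS57 BY NAME -/

/-- ★★ **TDS57 `TwistDegreeStepFiveSeven` (stmt-BirchSwinnertonDyer-22227) GRANTED ONLY hT₂ and P1-bar** (modularity is the item's own
first binder). Off the Kosters–Pannekoek sub-residue: `twistDegreeStep57_of_sl2NeronValuesBar_of_noTorsion` (every cell, de Rham
discharged, g18); on it: §2 and `twistDegreeStep57_of_not_dvd_c`. No F″, no Fontaine cite, no Ihara lemma, no KP57 hypothesis.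
CONDITIONAL; the item stays OPEN; BSD is not proved by this. [cite: Kato2004Asterisque, Thm. 6.6 (1) (p. 163), (8.1.3) (p. 180), Thm. 9.7 (p. 189)]
[cite: KostersPannekoek2017, Thm. 1 and Cor. 2] [cite: EdixhovenManin1991, §4 (cases 1/2)] [cite: ZagierCMB1985, §1 (p. 374)] -/
theorem twistDegreeStepFiveSeven_of_expStarTower_of_sl2NeronValuesBar
    (hT₂ : exists_smul_range_expStarCoord_tower_iff_trace_log) (hP1 : exists_member_sl2ZetaElement_neron_values_bar) :
    TwistDegreeStepFiveSeven := by
  intro hnf p _ V _ _ _ Wf _ _ _ C hp57 hadd hirr hK hV4 hC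
  have hp5 : 5 ≤ p := by omega
  by_cases hPT : ∀ (W' : WeierstrassCurve ℚ) [W'.IsElliptic] [W'.IsGloballyMinimal], IsIsogenous V W' →
      ∀ P : (W'.baseChange ℚ_[p]).toAffine.Point, p • P = 0 → P = 0
  · exact twistDegreeStep57_of_sl2NeronValuesBar_of_noTorsion hT₂ hP1 hnf V Wf C hp57 hadd hirr hK hV4 hC hPT
  push Not at hPT
  obtain ⟨W', hE', hM', hisoW', P, hP, hP0⟩ := hPT
  obtain ⟨D, hc⟩ := exists_datum_not_dvd_c_of_expStarTower_of_sl2NeronValuesBar_of_torsion hT₂ hP1 hnf V hp57 hadd hirr hK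
    ⟨W', hE', hM', P, hisoW', hP0, hP⟩
  exact ⟨D, TwistDegreeStepFiveSeven.twistDegreeStep57_of_not_dvd_c hp5 V Wf hadd hK hV4 C hC D hc⟩

/-- ★★ **TDS57 `TwistDegreeStepFiveSeven` (stmt-BirchSwinnertonDyer-22227) GRANTED ONLY Kato's explicit reciprocity law [REC-tower] and
P1-bar** — the same two printed inputs as K★ (22226) and TDS11 (22228). CONDITIONAL; the item stays OPEN; BSD is not proved by this.
[cite: Kato1993LNM1553, Ch. II Thm. 1.4.1 (4), Lemma 1.4.3–1.4.5] [cite: Kato2004Asterisque, (8.1.3) (p. 180), Thm. 9.7 (p. 189)] -/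
theorem twistDegreeStepFiveSeven_of_reciprocityLaw_of_sl2NeronValuesBar
    (hrec : tatePairingPoint_eq_trace_expStar_log_tower) (hP1 : exists_member_sl2ZetaElement_neron_values_bar) :
    TwistDegreeStepFiveSeven :=
  twistDegreeStepFiveSeven_of_expStarTower_of_sl2NeronValuesBar
    (exists_smul_range_expStarCoord_tower_iff_trace_log_of_reciprocityLaw hrec) hP1

end Summit.BirchSwinnertonDyer.BirchSwinnertonDyer.Theorems.KPResidueOfReciprocityLaw

end
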